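import Mathlib
import HarnessLib
import Literature.Analysis.FluidPDE.VectorCalculus

/-!
# Route `UnthreadedDoor` / `ThreadingFlux`, crux `PoloidalLiouville` (stmt-NavierStokesRegularity-1222), antidynamo v2 skeleton (sha16 `4ebf5683127b`),
# WALL `stub_scalarLiouville`: the POINTWISE OBSTRUCTION to a KNSS-type gauge («H-form» of the vorticity equation)

Support file (seat leafhand-ns-unthreadeddoor-2 g3, cell decomp-ns), `--supports stmt-NavierStokesRegularity-1222 --as helper`; theorems only, pure
vector algebra in `ℝ³` (Mathlib + `Literature.Analysis.FluidPDE.VectorCalculus`).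

CONTEXT (paper, memo `WALL-STATUS-leafhand2-g3.md` §6a, evidence on the item).  An unthreaded field is `v = ∇φ + T y`, `ω = ∇T × y` (`y = x − x₀`).
For ANY scalar gauge `g` put `H := ∇T + g y`; then `ω = H × y`, `curl H = ∇g × y`, `Δω = ΔH × y − 2 curl H`, and the vorticity equation is
EQUIVALENT to `[H_t + (v·∇)H − ΔH + 2∇g] × y = R(g)`, `R(g) := D²φ·ω + ∇φ × ∇T + g ∇φ × y` (the terms `T ω` cancel, `ω·∇T = 0`).  KNSS's scalar
`η = ω_θ/ϖ` (Thm 5.2) is the axisymmetric case, where the gauge `g = −2∂_ρT` makes `R(g) = 0` and `H = η e₃` of constant direction.  AT A POINT, with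
`q := D²φ·ω`, `a := ∇φ`, `p := ∇T`, the question «is there a gauge value `g` with `R(g) × y = 0`?» is pure algebra, settled here:

* `hform_obstruction_identity` — for all `y a p q : ℝ³`:
  `⟪((q + a × p) × y) × ((a × y) × y), y⟫ = −‖y‖⁴ ⟪q,a⟫ + ‖y‖² ⟪a,y⟫ ⟪q,y⟫ − ‖y‖² ⟪a,y⟫ ⟪y, p × a⟫`
  (coordinates + `ring`).  With `q = D²φ·ω`, `ω = p × y = −r J∇_S T` (`J = n × ·`, `n = y/r`) and `Hess_{ℝ³}φ = Hess_{S_r}φ + (φ_r/r)⟨·,·⟩` on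
  tangent vectors, the right-hand side is `r⁵ · Hess_{S_r}φ (J∇_S T, ∇_S φ) = (r⁵/2) · (J∇_S T)(|∇_S φ|²)` (paper; checked numerically in the seat folder).
* `hform_obstruction_of_gauge` — if some `g : ℝ` has `(q + a × p + g • (a × y)) × y = 0` then that quantity VANISHES.  Contrapositive: where
  `|∇_S φ|²` is NOT constant along the vortex line (the `T`-level loop on the sphere) through the point, NO gauge kills the stretching source of the
  H-form — the precise sense in which KNSS's maximum-principle scalar does not survive off the zonal class (there `{T, φ_r}_{S_r} = 0` is the loop
  law forced by the dynamics, while `{T, |∇_Sφ|²}_{S_r} = 0` is the EXTRA condition a KNSS-type gauge needs).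

HONEST LABEL: vector algebra + a paper derivation recorded in the docstring; nothing here proves `stub_scalarLiouville`, `PoloidalLiouville` (1222), or
bears on Navier–Stokes regularity; no summit statement is proved. [folklore] [cite: KochNadirashviliSereginSverak2009, Thm 5.2 (arXiv:0709.3599 pp. 9–10); MajdaBertozziCUP2002, §1.1 (vector identities)]
-/

noncomputable section

-- the summit and its single sub-problem share the name (CONVENTIONS §1)
set_option linter.dupNamespace false

open scoped InnerProductSpace RealInnerProductSpace
open Literature.Analysis.FluidPDE

namespace Summit.NavierStokesRegularity.NavierStokesRegularity.Theorems.PoloidalLiouville.Antidynamo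

namespace HForm

/-- **The H-form gauge obstruction identity** (pure vector algebra in `ℝ³`): for all `y a p q`,
`⟪((q + a × p) × y) × ((a × y) × y), y⟫ = −‖y‖⁴ ⟪q,a⟫ + ‖y‖² ⟪a,y⟫ ⟪q,y⟫ − ‖y‖² ⟪a,y⟫ ⟪y, p × a⟫`. [folklore] -/
theorem hform_obstruction_identity (y a p q : EuclideanSpace ℝ (Fin 3)) :
    ⟪cross (cross (q + cross a p) y) (cross (cross a y) y), y⟫ =
      -(‖y‖ ^ 2) ^ 2 * ⟪q, a⟫ + ‖y‖ ^ 2 * ⟪a, y⟫ * ⟪q, y⟫ - ‖y‖ ^ 2 * ⟪a, y⟫ * ⟪y, cross p a⟫ := by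
  simp [cross, crossProduct, PiLp.inner_apply, Fin.sum_univ_three, EuclideanSpace.norm_sq_eq, Matrix.vecHead, Matrix.vecTail]
  ring

/-- **If a gauge value exists, the obstruction vanishes**: if `(q + a × p + g (a × y)) × y = 0` for some `g : ℝ`, then
`−‖y‖⁴ ⟪q,a⟫ + ‖y‖² ⟪a,y⟫ ⟪q,y⟫ − ‖y‖² ⟪a,y⟫ ⟪y, p × a⟫ = 0` (the source `(q + a × p) × y` is then `−g` times `(a × y) × y`, and a cross
product of parallel vectors vanishes). [folklore] -/
theorem hform_obstruction_of_gauge {y a p q : EuclideanSpace ℝ (Fin 3)} {g : ℝ}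
    (hg : cross (q + cross a p + g • cross a y) y = 0) :
    -(‖y‖ ^ 2) ^ 2 * ⟪q, a⟫ + ‖y‖ ^ 2 * ⟪a, y⟫ * ⟪q, y⟫ - ‖y‖ ^ 2 * ⟪a, y⟫ * ⟪y, cross p a⟫ = 0 := by
  rw [← hform_obstruction_identity]
  -- `(q + a × p) × y = −g • ((a × y) × y)`
  have hsplit : cross (q + cross a p) y = -(g • cross (cross a y) y) := by
    have h1 : cross (q + cross a p + g • cross a y) y = cross (q + cross a p) y + g • cross (cross a y) y := by
      ext i
      fin_cases i <;> simp [cross, crossProduct, Matrix.vecHead, Matrix.vecTail] <;> ring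
    rw [h1] at hg
    exact eq_neg_of_add_eq_zero_left hg
  rw [hsplit]
  have hpar : cross (-(g • cross (cross a y) y)) (cross (cross a y) y) = 0 := by
    ext i
    fin_cases i <;> simp [cross, crossProduct] <;> ring
  rw [hpar, inner_zero_left]

/-- **Contrapositive, the form used in the memo**: where the obstruction is non-zero, NO gauge value `g` makes `R(g) × y` vanish. [folklore] -/
theorem not_exists_gauge_of_obstruction_ne_zero {y a p q : EuclideanSpace ℝ (Fin 3)}
    (h : -(‖y‖ ^ 2) ^ 2 * ⟪q, a⟫ + ‖y‖ ^ 2 * ⟪a, y⟫ * ⟪q, y⟫ - ‖y‖ ^ 2 * ⟪a, y⟫ * ⟪y, cross p a⟫ ≠ 0) :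
    ¬ ∃ g : ℝ, cross (q + cross a p + g • cross a y) y = 0 :=
  fun ⟨_, hg⟩ => h (hform_obstruction_of_gauge hg)

end HForm

end Summit.NavierStokesRegularity.NavierStokesRegularity.Theorems.PoloidalLiouville.Antidynamo

end
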